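import Mathlib

/-!
# Tangency sets in `AG(2,p)`, dot-product normalisation: the conic and the parabola pencil

Wall-breaker axis "random-algebraic constructions" for the stub `stub_tangencySets` of the crux
`LevelOneGL2Designs` (item stmt-MatrixMultiplication-14080, route LevelGradedCohnUmans).

The stub asks for `S ⊆ 𝔽_p² × 𝔽_p²` with `x_f ⬝ y_{f'} = 1 ↔ f = f'` and `|S| ≥ c·p^{3/2}` for
unboundedly many primes `p` — a strong representative system (tangency set) of the affine plane:
the points `x_f` together with the tangent lines `{z | z ⬝ y_f = 1}`.

This file proves, for EVERY prime `p`: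

* `parabola_srs` — the flags `t ↦ ((t, t²), (2/t, −1/t²))`, `t ≠ 0`, of the parabola `y = x²`
  form such an `S` of size `p − 1` (exponent `1`: the conic calibration);
* `pencil_srs` — for a set `R ⊆ 𝔽_p` whose pairwise differences are all NON-squares (an
  independent set of the Paley graph), the flags of the pencil of parabolas `y = x² + r`, `r ∈ R`,
  form such an `S` of size `≥ |R|·(p − 2)`: the tangent at `(a, a²+r)` meets `y = x² + r'` iff
  `(x − a)² = r − r'` is soluble;
* `tangencySets_of_paleyCocliques` — hence the stub's conclusion follows from Paley independent
  sets of size `c·√p` for unboundedly many primes.  This is the exact residual of the pencil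
  sub-axis; it is the (conjecturally false, provably open) Paley clique problem, which is why the
  pencil constructions stall at `Θ(p · ω(Paley_p)) = p^{1+o(1)}`.

No new definitions; Mathlib only.
-/

set_option linter.dupNamespace false

namespace Summit.MatrixMultiplication.MatrixMultiplication.Theorems.LevelOneGL2Designs.TangencyRandAlg

open Finset Matrix

variable (p : ℕ) [hp : Fact p.Prime]

/-- **Conic calibration.** For every prime `p` there is a dot-product design
`S ⊆ 𝔽_p² × 𝔽_p²` (i.e. `x_f ⬝ y_{f'} = 1 ↔ f = f'`) of size exactly `p − 1`: the flags
`((t, t²), (2/t, −1/t²))`, `t ≠ 0`, of the parabola `y = x²` (point and tangent line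
`2t·X − Y = t²`, rescaled so that the right-hand side is `1`). -/
theorem parabola_srs :
    ∃ S : Finset ((Fin 2 → ZMod p) × (Fin 2 → ZMod p)), S.card = p - 1 ∧
      ∀ f ∈ S, ∀ f' ∈ S, (dotProduct f.1 f'.2 = 1 ↔ f = f') := by
  classical
  let φ : ZMod p → (Fin 2 → ZMod p) × (Fin 2 → ZMod p) :=
    fun t => (![t, t ^ 2], ![2 / t, -1 / t ^ 2])
  have hφ : Function.Injective φ := by
    intro t t' h
    have := congrArg (fun f : (Fin 2 → ZMod p) × (Fin 2 → ZMod p) => f.1 0) h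
    simpa [φ] using this
  refine ⟨(univ.filter fun t : ZMod p => t ≠ 0).image φ, ?_, ?_⟩
  · rw [card_image_of_injective _ hφ, filter_ne' univ (0 : ZMod p), card_erase_of_mem (mem_univ _),
      card_univ, ZMod.card]
  · intro f hf f' hf'
    simp only [mem_image, mem_filter, mem_univ, true_and] at hf hf'
    obtain ⟨t, ht, rfl⟩ := hf
    obtain ⟨t', ht', rfl⟩ := hf'
    have key : dotProduct (φ t).1 (φ t').2 = 1 ↔ t = t' := by
      simp only [φ, dotProduct, Fin.sum_univ_two, cons_val_zero, cons_val_one]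
      constructor
      · intro h
        have h2 : 2 * t * t' - t ^ 2 = t' ^ 2 := by
          field_simp at h
          linear_combination h
        have h3 : (t - t') ^ 2 = 0 := by linear_combination -h2
        exact sub_eq_zero.mp (pow_eq_zero_iff two_ne_zero |>.mp h3)
      · rintro rfl
        field_simp
        ring
    rw [key]
    constructor
    · rintro rfl; rfl
    · intro h; exact hφ h

/-- **Pencil amplification.** Let `R ⊆ 𝔽_p` have all pairwise differences non-squares (an
independent set of the Paley graph; for `|R| ≥ 2` this forces `p ≡ 1 (mod 4)`).  Then the flags
`((a, a² + r), (2a/(a² − r), −1/(a² − r)))`, `r ∈ R`, `a² ≠ r`, of the parabola pencil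
`y = x² + r` form a dot-product design of size at least `|R|·(p − 2)`: the tangent line at
`(a, a²+r)` meets the parabola `y = x² + r'` exactly in the points with `(x − a)² = r − r'`. -/
theorem pencil_srs (R : Finset (ZMod p))
    (hR : ∀ r ∈ R, ∀ r' ∈ R, r ≠ r' → ¬ IsSquare (r - r')) :
    ∃ S : Finset ((Fin 2 → ZMod p) × (Fin 2 → ZMod p)), R.card * (p - 2) ≤ S.card ∧
      ∀ f ∈ S, ∀ f' ∈ S, (dotProduct f.1 f'.2 = 1 ↔ f = f') := by
  classical
  let φ : ZMod p × ZMod p → (Fin 2 → ZMod p) × (Fin 2 → ZMod p) :=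
    fun ar => (![ar.1, ar.1 ^ 2 + ar.2], ![2 * ar.1 / (ar.1 ^ 2 - ar.2), -1 / (ar.1 ^ 2 - ar.2)])
  have hφ : Function.Injective φ := by
    rintro ⟨a, r⟩ ⟨b, r'⟩ h
    have h0 := congrArg (fun f : (Fin 2 → ZMod p) × (Fin 2 → ZMod p) => f.1 0) h
    have h1 := congrArg (fun f : (Fin 2 → ZMod p) × (Fin 2 → ZMod p) => f.1 1) h
    simp only [φ, cons_val_zero, cons_val_one] at h0 h1
    subst h0
    simpa using h1
  refine ⟨((univ ×ˢ R).filter fun ar => ar.1 ^ 2 ≠ ar.2).image φ, ?_, ?_⟩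
  · -- counting: for each `r`, at most two `a` with `a² = r`
    rw [card_image_of_injective _ hφ]
    have hbad : ((univ ×ˢ R).filter fun ar : ZMod p × ZMod p => ¬ ar.1 ^ 2 ≠ ar.2).card
        ≤ 2 * R.card := by
      have : ((univ ×ˢ R).filter fun ar : ZMod p × ZMod p => ¬ ar.1 ^ 2 ≠ ar.2)
          ⊆ R.biUnion fun r => (univ.filter fun a : ZMod p => a ^ 2 = r).image fun a => (a, r) := by
        rintro ⟨a, r⟩ h
        simp only [mem_filter, mem_product, mem_univ, true_and, not_not] at h
        simp only [mem_biUnion, mem_image, mem_filter, mem_univ, true_and, Prod.mk.injEq]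
        exact ⟨r, h.1, a, h.2, rfl, rfl⟩
      refine (card_le_card this).trans ((card_biUnion_le).trans ?_)
      rw [mul_comm, ← smul_eq_mul, ← sum_const]
      refine sum_le_sum fun r _ => ?_
      refine card_image_le.trans ?_
      by_cases hs : ∃ s : ZMod p, s ^ 2 = r
      · obtain ⟨s, rfl⟩ := hs
        have : (univ.filter fun a : ZMod p => a ^ 2 = s ^ 2) ⊆ {s, -s} := by
          intro a ha
          simp only [mem_filter, mem_univ, true_and] at ha
          simpa using (sq_eq_sq_iff_eq_or_eq_neg.mp ha)
        exact (card_le_card this).trans (card_insert_le _ _)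
      · have : (univ.filter fun a : ZMod p => a ^ 2 = r) = ∅ := by
          ext a
          simp only [mem_filter, mem_univ, true_and, Finset.notMem_empty, iff_false]
          exact fun h => hs ⟨a, h⟩
        simp [this]
    have hsplit := card_filter_add_card_filter_not
      (s := (univ : Finset (ZMod p)) ×ˢ R) (fun ar : ZMod p × ZMod p => ar.1 ^ 2 ≠ ar.2)
    rw [card_product, card_univ, ZMod.card] at hsplit
    have h2 : R.card * (p - 2) = p * R.card - 2 * R.card := by
      rw [Nat.mul_sub, mul_comm]
      ring_nf
    omega
  · intro f hf f' hf'
    simp only [mem_image] at hf hf'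
    obtain ⟨⟨a, r⟩, har, rfl⟩ := hf
    obtain ⟨⟨b, r'⟩, hbr, rfl⟩ := hf'
    simp only [mem_filter, mem_product, mem_univ, true_and] at har hbr
    have hb : b ^ 2 - r' ≠ 0 := sub_ne_zero.mpr hbr.2
    have key : dotProduct (φ (a, r)).1 (φ (b, r')).2 = 1 ↔ (a - b) ^ 2 = r' - r := by
      simp only [φ, dotProduct, Fin.sum_univ_two, cons_val_zero, cons_val_one]
      constructor
      · intro h
        field_simp at h
        linear_combination -h
      · intro h
        field_simp
        linear_combination -h
    rw [key]
    constructor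
    · intro h
      by_cases hrr : r' = r
      · subst hrr
        have hab : a = b := by
          have : (a - b) ^ 2 = 0 := by rw [h, sub_self]
          exact sub_eq_zero.mp (pow_eq_zero_iff two_ne_zero |>.mp this)
        subst hab
        rfl
      · exact absurd ⟨a - b, by rw [← h]; ring⟩ (hR r' hbr.1 r har.1 hrr)
    · intro h
      have := hφ h
      simp only [Prod.mk.injEq] at this
      obtain ⟨rfl, rfl⟩ := this
      ring

/-- **The residual of the pencil sub-axis.**  If for some `c > 0` and unboundedly many primes `p`
the Paley graph on `𝔽_p` has an independent set `R` (pairwise differences non-squares) of size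
`≥ c·√p`, then the stub `stub_tangencySets` holds (with constant `c/2`).  The hypothesis is the
Paley clique problem (Paley graphs are self-complementary); the proven record is
`ω(Paley_p) ≤ √(p/2) + 1` from above and `Ω(log p · log log log p)` infinitely often from below, and
`ω(Paley_p) = p^{o(1)}` is the standard conjecture — so this documents exactly why pencils of conics
cannot deliver exponent `3/2` over prime fields. -/
theorem tangencySets_of_paleyCocliques
    (h : ∃ c : ℝ, 0 < c ∧ ∀ p₀ : ℕ, ∃ (p : ℕ) (_ : Fact p.Prime), p₀ ≤ p ∧
      ∃ R : Finset (ZMod p), c * (p : ℝ) ^ (1 / 2 : ℝ) ≤ R.card ∧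
        ∀ r ∈ R, ∀ r' ∈ R, r ≠ r' → ¬ IsSquare (r - r')) :
    ∃ c : ℝ, 0 < c ∧ ∀ p₀ : ℕ, ∃ (p : ℕ) (_ : Fact p.Prime), p₀ ≤ p ∧
      ∃ S : Finset ((Fin 2 → ZMod p) × (Fin 2 → ZMod p)),
        c * (p : ℝ) ^ (3 / 2 : ℝ) ≤ S.card ∧
        ∀ f ∈ S, ∀ f' ∈ S, (dotProduct f.1 f'.2 = 1 ↔ f = f') := by
  obtain ⟨c, hc, hfam⟩ := h
  refine ⟨c / 2, by positivity, fun p₀ => ?_⟩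
  obtain ⟨q, hq, hq₀, R, hRcard, hR⟩ := hfam (max p₀ 4)
  obtain ⟨S, hScard, hS⟩ := pencil_srs q R hR
  refine ⟨q, hq, le_of_max_le_left hq₀, S, ?_, hS⟩
  have hq4 : (4 : ℝ) ≤ q := by exact_mod_cast le_of_max_le_right hq₀
  have hq2 : (2 : ℕ) ≤ q := by
    have := le_of_max_le_right hq₀; omega
  have hcardR : (R.card : ℝ) * (q - 2 : ℝ) ≤ S.card := by
    have : ((R.card * (q - 2) : ℕ) : ℝ) ≤ S.card := by exact_mod_cast hScard
    push_cast [Nat.cast_sub hq2] at this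
    exact this
  have hsqrt : (0 : ℝ) ≤ (q : ℝ) ^ (1 / 2 : ℝ) := Real.rpow_nonneg (Nat.cast_nonneg _) _
  have hpow : (q : ℝ) ^ (3 / 2 : ℝ) = (q : ℝ) ^ (1 / 2 : ℝ) * q := by
    rw [show (3 / 2 : ℝ) = 1 / 2 + 1 by norm_num,
      Real.rpow_add_one (by positivity : (q : ℝ) ≠ 0), mul_comm]
  calc c / 2 * (q : ℝ) ^ (3 / 2 : ℝ)
      = c * (q : ℝ) ^ (1 / 2 : ℝ) * (q / 2) := by rw [hpow]; ring
    _ ≤ c * (q : ℝ) ^ (1 / 2 : ℝ) * (q - 2) := by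
        apply mul_le_mul_of_nonneg_left (by linarith) (by positivity)
    _ ≤ R.card * (q - 2 : ℝ) := by
        apply mul_le_mul_of_nonneg_right hRcard (by linarith)
    _ ≤ S.card := hcardR

end Summit.MatrixMultiplication.MatrixMultiplication.Theorems.LevelOneGL2Designs.TangencyRandAlg
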